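import Mathlib.FieldTheory.Finite.Basic
import Mathlib.NumberTheory.Padics.PadicVal.Basic
import Mathlib.GroupTheory.OrderOfElement
import HarnessLib

/-!
# The residue-field order computation behind `stub_chebotarevSupplyAtThree` (crux 19109, line `inert`;
# STUB-PLAN part C3 (iii)): from a Frobenius with `σ² c ≠ c` to `3^e ∣ d`

Crux `stmt-BirchSwinnertonDyer-19109` (`EulerHalvesAtThree`), line `inert` (tam3-p1 g18, skeleton r19),
registered stub `stub_chebotarevSupplyAtThree`.  In the DICTIONARY part of its proof a Frobenius `σ` at a
prime `𝔓 ∣ ℓ` of `ℤ̄` acts on the residue field `F = ℤ̄/𝔓` by `x ↦ x^ℓ`; the data of the Kummer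
picture reduce to elements of `F`: `b = β̄`, `b' = β̄' = b^ℓ` (`σ` acts as complex conjugation on `K`),
`g₂ = γ̄₂` (fixed by `σ²`), `C = c̄` with `C³ = ḡ` and `C^{ℓ²} = θ C`, `θ ≠ 1` a cube root of unity
(`σ²` MOVES the cube root `c`), the relation `β γ₂^{3^{k+1}} = β' g^{3^k}` (i.e. `β/β' = γ₀^{3^k}`,
`γ₀ = g/γ₂³`), and `3^{e+k} ∣ ℓ + 1`.  This file proves the purely algebraic conclusion:
**if `b^d` lies in the prime field (`(b^d)^ℓ = b^d`, i.e. `β^d ≡ a (mod ℓ𝓞_K)` with `a ∈ ℤ`) then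
`3^e ∣ d`** — with `u = C/g₂`: `u^{3^{k+1} d} = 1`, `u^{ℓ²−1} = θ ≠ 1`, `u^{3(ℓ²−1)} = 1`, so
`v₃(ord u) = v₃(ℓ² − 1) + 1 ≥ e + k + 1` while `ord u ∣ 3^{k+1} d`.

* `pow_succ_padicValNat_dvd_of_dvd_mul_of_not_dvd` — `t ∣ pM`, `t ∤ M ⟹ p^{v_p(M)+1} ∣ t` (elementary);
* `three_pow_dvd_of_frobenius_data` — the statement above, for any field `F` and prime `ℓ`.

Pure algebra.  HONEST FRAMING: a helper toward one registered stub of one line of crux 19109; BSD is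
proved for no curve here.

## References

* J. Neukirch, *Algebraic Number Theory* (1999), Ch. I §8 (residue fields, Frobenius `x ↦ x^q`). [NeukirchANT1999]

## Mathlib / tree search

Mathlib: `orderOf_dvd_of_pow_eq_one`, `orderOf_dvd_iff_pow_eq_one`, `padicValNat`,
`padicValNat_dvd_iff_le`, `pow_padicValNat_dvd`, `Nat.Coprime.dvd_of_dvd_mul_left`,
`Nat.coprime_ordCompl`, `Nat.ordProj_mul_ordCompl_eq_self`.
`lean search 'orderOf.*padicValNat.*dvd'` (2026-08-28): nothing reusable.
-/

set_option autoImplicit false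
set_option linter.dupNamespace false

namespace Summit.BirchSwinnertonDyer.BirchSwinnertonDyer.Theorems.ChebSupply

/-! ## §1 Elementary: `t ∣ 3M`, `t ∤ M ⟹ 3^{v₃(M)+1} ∣ t` -/

/-- **`t ∣ p·M` and `t ∤ M` force `p^{v_p(M)+1} ∣ t`** (`p` prime, `M ≠ 0`): write `t = p^a t'`
with `p ∤ t'`; then `t' ∣ M`, and `a ≤ v_p(M)` would give `t ∣ M` (for `M = 0` read `v_p(0) = 0`). [folklore] -/
theorem pow_succ_padicValNat_dvd_of_dvd_mul_of_not_dvd {p t M : ℕ} (hp : p.Prime)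
    (h1 : t ∣ p * M) (h2 : ¬ t ∣ M) : p ^ (padicValNat p M + 1) ∣ t := by
  haveI : Fact p.Prime := ⟨hp⟩
  have ht0 : t ≠ 0 := by
    rintro rfl
    exact h2 (by rw [zero_dvd_iff] at h1 ⊢; exact (mul_eq_zero.mp h1).resolve_left hp.ne_zero)
  -- `t = p^a · t'`, `p ∤ t'`
  set a := padicValNat p t with ha
  obtain ⟨t', ht', hcop⟩ : ∃ t', t = p ^ a * t' ∧ ¬ p ∣ t' := by
    refine ⟨t / p ^ a, (Nat.mul_div_cancel' pow_padicValNat_dvd).symm, fun hdvd => ?_⟩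
    apply pow_succ_padicValNat_not_dvd (p := p) ht0
    rw [pow_succ]
    conv_rhs => rw [← Nat.mul_div_cancel' (pow_padicValNat_dvd (p := p) (n := t))]
    exact Nat.mul_dvd_mul_left _ hdvd
  -- `t' ∣ M`
  have ht'M : t' ∣ M := by
    have h3 : t' ∣ p * M := (Dvd.intro_left _ ht'.symm).trans h1
    exact (Nat.Coprime.dvd_of_dvd_mul_left ((Nat.Prime.coprime_iff_not_dvd hp).mpr hcop).symm h3)
  -- `a ≥ v_p(M) + 1`, else `t ∣ M`
  have ha_le : padicValNat p M + 1 ≤ a := by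
    by_contra hlt
    push Not at hlt
    apply h2
    have hpa : p ^ a ∣ M := (pow_dvd_pow p (Nat.lt_succ_iff.mp hlt)).trans pow_padicValNat_dvd
    rw [ht']
    exact Nat.Coprime.mul_dvd_of_dvd_of_dvd
      (Nat.Coprime.pow_left a ((Nat.Prime.coprime_iff_not_dvd hp).mpr hcop)) hpa ht'M
  calc p ^ (padicValNat p M + 1) ∣ p ^ a := pow_dvd_pow p ha_le
    _ ∣ t := ht' ▸ Dvd.intro t' rfl

/-! ## §2 The order computation in the residue field -/

/-- **From the Frobenius data to `3^e ∣ d`.**  In a field `F`, let `ℓ` be a prime with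
`3^{e+k} ∣ ℓ + 1`, `b, g₂, C ∈ F` non-zero and `θ ∈ F` with `θ³ = 1`, `θ ≠ 1`, such that
`C^{ℓ²} = θ·C` (the square of the Frobenius moves the cube root), `g₂^{ℓ²} = g₂`, and
`b · g₂^{3^{k+1}} = b^ℓ · (C³)^{3^k}` (the relation `β γ₂^{3^{k+1}} = β' g^{3^k}`, `β' = σβ ≡ β^ℓ`,
`C³ = g`).  If `(b^d)^ℓ = b^d` (`β^d ≡ a ∈ ℤ (mod λ)`) then **`3^e ∣ d`**. [folklore] -/
theorem three_pow_dvd_of_frobenius_data {F : Type*} [Field F] {ℓ e k : ℕ} (hℓ : ℓ.Prime)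
    (hE : 3 ^ (e + k) ∣ ℓ + 1) {b g₂ C θ : F} (hb : b ≠ 0) (hg₂ : g₂ ≠ 0) (hC : C ≠ 0)
    (hθ3 : θ ^ 3 = 1) (hθ1 : θ ≠ 1) (hCfrob : C ^ (ℓ ^ 2) = θ * C) (hg₂frob : g₂ ^ (ℓ ^ 2) = g₂)
    (hrel : b * g₂ ^ 3 ^ (k + 1) = b ^ ℓ * (C ^ 3) ^ 3 ^ k) {d : ℕ} (hd : (b ^ d) ^ ℓ = b ^ d) :
    3 ^ e ∣ d := by
  -- trivial when `e = 0`
  rcases Nat.eq_zero_or_pos e with rfl | he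
  · rw [pow_zero]; exact one_dvd d
  have hℓ2 : 2 ≤ ℓ := hℓ.two_le
  -- `u := C / g₂` has `u^{3^{k+1} d} = 1`
  set u := C / g₂ with hu
  have hu0 : u ≠ 0 := div_ne_zero hC hg₂
  set N := 3 ^ (k + 1) * d with hN
  have hrel_d : b ^ d * g₂ ^ (3 ^ (k + 1) * d) = b ^ d * C ^ (3 ^ (k + 1) * d) := by
    have h := congrArg (fun z => z ^ d) hrel
    simp only [mul_pow, ← pow_mul] at h
    rw [h, mul_comm ℓ d, pow_mul, hd]
    ring_nf
  have huN : u ^ N = 1 := by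
    rw [hu, div_pow, div_eq_one_iff_eq (pow_ne_zero _ hg₂), hN]
    exact (mul_left_cancel₀ (pow_ne_zero d hb) hrel_d).symm
  -- `u^{ℓ²-1} = θ ≠ 1`, `u^{3(ℓ²-1)} = 1`
  have hℓ21 : 1 ≤ ℓ ^ 2 := Nat.one_le_pow _ _ hℓ.pos
  have huM : u ^ (ℓ ^ 2 - 1) = θ := by
    have h1 : u ^ (ℓ ^ 2) = θ * u := by
      rw [hu, div_pow, hCfrob, hg₂frob, mul_div_assoc]
    have h2 : u ^ (ℓ ^ 2) = u ^ (ℓ ^ 2 - 1) * u := by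
      rw [← pow_succ, Nat.sub_add_cancel hℓ21]
    rw [h2] at h1
    exact mul_right_cancel₀ hu0 h1
  have hord1 : ¬ orderOf u ∣ ℓ ^ 2 - 1 := by
    rw [orderOf_dvd_iff_pow_eq_one, huM]; exact hθ1
  have hord2 : orderOf u ∣ 3 * (ℓ ^ 2 - 1) := by
    rw [orderOf_dvd_iff_pow_eq_one, mul_comm, pow_mul, huM, hθ3]
  have hord3 : orderOf u ∣ N := orderOf_dvd_of_pow_eq_one huN
  -- `3^{v₃(ℓ²-1)+1} ∣ orderOf u ∣ 3^{k+1} d`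
  have hM0 : ℓ ^ 2 - 1 ≠ 0 := by
    have : 4 ≤ ℓ ^ 2 := by nlinarith
    omega
  have hkey := pow_succ_padicValNat_dvd_of_dvd_mul_of_not_dvd Nat.prime_three hord2 hord1
  -- `v₃(ℓ² - 1) ≥ e + k`
  haveI : Fact (Nat.Prime 3) := ⟨Nat.prime_three⟩
  have hEM : e + k ≤ padicValNat 3 (ℓ ^ 2 - 1) := by
    rw [← padicValNat_dvd_iff_le hM0]
    have hfac : ℓ ^ 2 - 1 = (ℓ - 1) * (ℓ + 1) := by
      zify [hℓ21, hℓ.one_lt.le]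
      ring
    rw [hfac]
    exact Dvd.dvd.mul_left hE _
  -- combine: `3^{e+k+1} ∣ 3^{k+1} d`
  have h4 : 3 ^ (e + k + 1) ∣ 3 ^ (k + 1) * d :=
    ((pow_dvd_pow 3 (Nat.succ_le_succ hEM)).trans hkey).trans hord3
  rw [show e + k + 1 = (k + 1) + e by ring, pow_add] at h4
  exact (Nat.mul_dvd_mul_iff_left (pow_pos (by norm_num) _)).mp h4

end Summit.BirchSwinnertonDyer.BirchSwinnertonDyer.Theorems.ChebSupply
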